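import Mathlib.AlgebraicGeometry.Morphisms.Etale
import Mathlib.AlgebraicGeometry.Morphisms.FormallyUnramified
import Mathlib.RingTheory.Unramified.Locus
import HarnessLib

/-!
# Étale (resp. unramified) NEAR A POINT from the stalk: a morphism locally of finite presentation and flat whose stalk map
# at `x` is formally unramified is étale on an open neighbourhood of `x` ([StacksProject 02G8, 02GU, 08WD]; [EGAIV4] 17.4.1, 17.6.1)

Topic `Literature/AlgebraicGeometry/Morphisms`; namespace `Literature.AlgebraicGeometry.Morphisms`.  PROOF FILE (theorems only; no
definition, no named fact, no instance, no `sorry`; Mathlib-only imports).  Cell `hodgecm-mathlib` (D-0151), FLOOR 0, programme F0P5a,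
(γ3-generic) row **Γ3-E1a, scheme-plumbing piece (sch3)** (F0P5a-plan (g2) `Gamma3-ROWS.v0`, desk `Gamma3-DESK.v0.1` :124
`EtaleNearOfFlatOfSpecialFibreOpenImmersion`; consumer Γ3-E1 `FibreCountOneOfEtaleNear`, whose binder is exactly
`(U : X.Opens) [Etale (U.ι ≫ f)]` with `x ∈ U`).

Mathlib has the GLOBAL dictionary `Etale f ↔ Flat f ∧ FormallyUnramified f ∧ LocallyOfFinitePresentation f`
(`AlgebraicGeometry.Etale.iff_flat_and_formallyUnramified`), the forward pointwise statement `FormallyUnramified f → (f.stalkMap x)`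
formally unramified (`FormallyUnramified.stalkMap`), and at RING level the openness of the unramified ∕ étale loci
(`Algebra.exists_formallyUnramified_of_isUnramifiedAt`, `Algebra.IsEtaleAt.of_isUnramifiedAt_of_flat`).  This file supplies the converse
POINTWISE-TO-LOCAL statements for schemes:

* §1 `Algebra.isUnramifiedAt_of_formallyUnramified_localRingHom` — (rings) if the induced map of local rings `R_p → S_q` is formally
  unramified then `S` is unramified at `q` (`R → R_p` is a localisation, hence formally unramified; compose).
* §2 `exists_formallyUnramified_of_formallyUnramified_stalkMap` — **(schemes) for `f : X ⟶ Y` locally of finite type and a point `x`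
  with `(f.stalkMap x)` formally unramified there is an open `U ∋ x` with `FormallyUnramified (U.ι ≫ f)`**: affine opens `x ∈ V ⊆ f⁻¹U`
  (Mathlib `arrowStalkMapIso`: the stalk map IS `Localization.localRingHom` of `f.appLE U V`), §1, the ring-level open unramified
  locus gives a basic open `X.basicOpen r ∋ x` on which `Γ(Y, U) → Γ(X, X.basicOpen r)` is formally unramified, and
  `HasRingHomProperty` turns that into the scheme statement for `(X.basicOpen r).ι ≫ f = f.resLE … ≫ U.ι`.
* §3 `exists_etale_of_formallyUnramified_stalkMap` — **for `f` FLAT and locally of finite presentation, `(f.stalkMap x)` formally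
  unramified ⇒ `∃ U ∋ x, Etale (U.ι ≫ f)`** (§2 + Mathlib `Etale.of_formallyUnramified_of_flat` on the restriction);
  `exists_etale_of_isIso_stalkMap` — in particular when the stalk map at `x` is an ISOMORPHISM (e.g. `f` restricted to some locally
  closed piece through `x` is an open immersion at the level of local rings).

Ours (formalisation glue over Mathlib); axioms `propext`, `Classical.choice`, `Quot.sound`.

## References
* [StacksProject] The Stacks Project, Tag 02G8 (unramified at a point), Tag 02GU (étale at a point; the étale locus is open),
  Tag 08WD (flat + unramified + lfp ⇔ étale), Tag 00UV.
* [EGAIV4] A. Grothendieck, J. Dieudonné, EGA IV₄ (Publ. Math. IHÉS 32, 1967), Thm. 17.4.1, Thm. 17.6.1, Cor. 18.4.12.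
-/

set_option autoImplicit false

noncomputable section

open CategoryTheory CategoryTheory.Limits TopologicalSpace AlgebraicGeometry

namespace Literature.AlgebraicGeometry.Morphisms

universe u

/-! ## §1 Rings: unramified at `q` from the map of local rings `R_p → S_q` -/

/-- **Unramified at `q` from the local homomorphism `R_p → S_q`.**  For an `R`-algebra `S`, a prime `q` of `S` and `p` its contraction, if
`Localization.localRingHom p q : R_p → S_q` is formally unramified then `S` is unramified at `q` (`Algebra.IsUnramifiedAt R q`, i.e.
`R → S_q` formally unramified): `R → R_p` is a localisation, hence formally unramified (Mathlib `FormallyUnramified.of_isLocalization`),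
and formally unramified maps compose. [cite: StacksProject, Tag 02G8 and Tag 00UV] -/
theorem Algebra.isUnramifiedAt_of_formallyUnramified_localRingHom {R S : Type u} [CommRing R] [CommRing S] [Algebra R S]
    (p : Ideal R) [p.IsPrime] (q : Ideal S) [q.IsPrime] (hpq : p = q.comap (algebraMap R S))
    (h : (Localization.localRingHom p q (algebraMap R S) hpq).FormallyUnramified) :
    Algebra.IsUnramifiedAt R q := by
  let Rp := Localization.AtPrime p
  let Sq := Localization.AtPrime q
  letI : Algebra Rp Sq := (Localization.localRingHom p q (algebraMap R S) hpq).toAlgebra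
  haveI : IsScalarTower R Rp Sq := IsScalarTower.of_algebraMap_eq fun r => by
    rw [RingHom.algebraMap_toAlgebra, Localization.localRingHom_to_map, IsScalarTower.algebraMap_apply R S Sq]
  haveI : Algebra.FormallyUnramified Rp Sq := h
  haveI : Algebra.FormallyUnramified R Rp := Algebra.FormallyUnramified.of_isLocalization (M := p.primeCompl)
  exact Algebra.FormallyUnramified.comp R Rp Sq

/-! ## §2 Schemes: formally unramified near `x` from the stalk map at `x` -/

section Scheme

variable {X Y : Scheme.{u}} (f : X ⟶ Y)

/-- **Formally unramified on a neighbourhood from the stalk** ([StacksProject 02G8]: «`f` is unramified at `x`» is an open condition and is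
read on `𝒪_{Y,f x} → 𝒪_{X,x}`): for `f : X ⟶ Y` locally of finite type and `x ∈ X` with `f.stalkMap x` formally unramified, there is an open
`U ∋ x` of `X` with `FormallyUnramified (U.ι ≫ f)`.  PROOF: choose affine opens `x ∈ V ⊆ f⁻¹ U₀`; the stalk map is `Localization.localRingHom`
of `φ = f.appLE U₀ V` (Mathlib `IsAffineOpen.arrowStalkMapIso`), so `Γ(X, V)` is unramified over `Γ(Y, U₀)` at the prime of `x` (§1); the
unramified locus of the finite-type algebra `Γ(X, V)` is open (Mathlib `Algebra.exists_formallyUnramified_of_isUnramifiedAt`), giving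
`r ∉ 𝔮_x` with `Γ(Y, U₀) → Γ(X, V)_r = Γ(X, X.basicOpen r)` formally unramified; `HasRingHomProperty` (pointwise form `iff_exists_appLE`)
converts this into `FormallyUnramified ((X.basicOpen r).ι ≫ f)`. [cite: StacksProject, Tag 02G8] [cite: EGAIV4, Thm. 17.4.1] -/
theorem exists_formallyUnramified_of_formallyUnramified_stalkMap [LocallyOfFiniteType f] (x : X)
    (hx : (f.stalkMap x).hom.FormallyUnramified) :
    ∃ U : X.Opens, x ∈ U ∧ FormallyUnramified (U.ι ≫ f) := by
  classical
  -- affine opens `x ∈ V ⊆ f ⁻¹ U₀`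
  obtain ⟨U₀, hU₀, hfx, -⟩ := Opens.isBasis_iff_nbhd.mp Y.isBasis_affineOpens (Opens.mem_top (f x))
  obtain ⟨V, hV, hxV, e⟩ := Opens.isBasis_iff_nbhd.mp X.isBasis_affineOpens (show x ∈ f ⁻¹ᵁ U₀ from hfx)
  -- ring data: `φ : R → S`, finite type
  set φ := (f.appLE U₀ V e).hom with hφ
  algebraize [φ]
  have hft : φ.FiniteType := HasRingHomProperty.appLE @LocallyOfFiniteType f inferInstance ⟨U₀, hU₀⟩ ⟨V, hV⟩ e
  haveI : Algebra.FiniteType Γ(Y, U₀) Γ(X, V) := hft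
  -- unramified at the prime `𝔮` of `x`, from the stalk
  have hq : Algebra.IsUnramifiedAt Γ(Y, U₀) (hV.primeIdealOf ⟨x, hxV⟩).asIdeal := by
    have h := (RingHom.FormallyUnramified.respectsIso.arrow_mk_iso_iff
      (IsAffineOpen.arrowStalkMapIso f U₀ hU₀ V hV e hxV)).mp hx
    exact Algebra.isUnramifiedAt_of_formallyUnramified_localRingHom (R := Γ(Y, U₀)) (S := Γ(X, V))
      (hU₀.primeIdealOf ⟨f x, e hxV⟩).asIdeal (hV.primeIdealOf ⟨x, hxV⟩).asIdeal
      (PrimeSpectrum.ext_iff.mp (IsAffineOpen.comap_primeIdealOf_appLE U₀ hU₀ V hV e hxV)).symm h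
  -- a basic open `X.basicOpen r ∋ x` over which `R → S_r` is formally unramified
  obtain ⟨r, hrq, hr⟩ := Algebra.exists_formallyUnramified_of_isUnramifiedAt (R := Γ(Y, U₀)) (hV.primeIdealOf ⟨x, hxV⟩).asIdeal
  have hxr : x ∈ X.basicOpen r := by
    have h1 : hV.fromSpec (hV.primeIdealOf ⟨x, hxV⟩) ∈ X.basicOpen r ↔
        hV.primeIdealOf ⟨x, hxV⟩ ∈ hV.fromSpec ⁻¹ᵁ X.basicOpen r := Iff.rfl
    rw [hV.fromSpec_primeIdealOf ⟨x, hxV⟩] at h1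
    rw [h1, hV.fromSpec_preimage_basicOpen r]
    exact hrq
  refine ⟨X.basicOpen r, hxr, ?_⟩
  -- the restriction `R → Γ(X, X.basicOpen r)` is formally unramified (transport along `S_r ≅ Γ(X, X.basicOpen r)`)
  have hle : X.basicOpen r ≤ f ⁻¹ᵁ U₀ := (X.basicOpen_le r).trans e
  haveI : IsLocalization.Away r Γ(X, X.basicOpen r) := hV.isLocalization_basicOpen r
  have happ : (f.appLE U₀ (X.basicOpen r) hle).hom =
      (algebraMap Γ(X, V) Γ(X, X.basicOpen r)).comp φ := by
    rw [hφ, RingHom.algebraMap_toAlgebra, ← CommRingCat.hom_comp, Scheme.Hom.appLE_map]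
  have hQ : (f.appLE U₀ (X.basicOpen r) hle).hom.FormallyUnramified := by
    rw [happ]
    letI : Algebra Γ(Y, U₀) Γ(X, X.basicOpen r) := ((algebraMap Γ(X, V) Γ(X, X.basicOpen r)).comp φ).toAlgebra
    haveI : IsScalarTower Γ(Y, U₀) Γ(X, V) Γ(X, X.basicOpen r) := IsScalarTower.of_algebraMap_eq fun _ => rfl
    have e' : Localization.Away r ≃ₐ[Γ(Y, U₀)] Γ(X, X.basicOpen r) :=
      (IsLocalization.algEquiv (Submonoid.powers r) (Localization.Away r) Γ(X, X.basicOpen r)).restrictScalars Γ(Y, U₀)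
    haveI : Algebra.FormallyUnramified Γ(Y, U₀) Γ(X, X.basicOpen r) := Algebra.FormallyUnramified.of_equiv e'
    exact RingHom.formallyUnramified_algebraMap.mpr this
  -- `(X.basicOpen r).ι ≫ f = f.resLE U₀ (X.basicOpen r) ≫ U₀.ι`, and `FormallyUnramified` of the affine piece is read on `appTop`
  haveI : IsAffine (X.basicOpen r) := hV.basicOpen r
  haveI : IsAffine U₀ := hU₀
  have hres : FormallyUnramified (f.resLE U₀ (X.basicOpen r) hle) := by
    rw [HasRingHomProperty.iff_of_isAffine (P := @FormallyUnramified), Scheme.Hom.appTop, Scheme.Hom.resLE_app_top]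
    exact (RingHom.FormallyUnramified.respectsIso.cancel_left_isIso _ _).mpr
      ((RingHom.FormallyUnramified.respectsIso.cancel_right_isIso _ _).mpr hQ)
  rw [← Scheme.Hom.resLE_comp_ι f hle]
  exact MorphismProperty.comp_mem _ _ _ hres inferInstance

/-! ## §3 Étale near `x` -/

/-- **Étale on a neighbourhood from the stalk** ([StacksProject 02GU, 08WD]; [EGAIV4] 17.6.1): for `f : X ⟶ Y` FLAT and locally of finite
presentation and a point `x` with `f.stalkMap x` formally unramified, there is an open `U ∋ x` with `Etale (U.ι ≫ f)` (§2 gives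
`FormallyUnramified (U.ι ≫ f)`; the restriction is still flat and locally of finite presentation; Mathlib
`Etale.of_formallyUnramified_of_flat`). [cite: StacksProject, Tag 02GU and Tag 08WD] [cite: EGAIV4, Thm. 17.6.1] -/
theorem exists_etale_of_formallyUnramified_stalkMap [Flat f] [LocallyOfFinitePresentation f] (x : X)
    (hx : (f.stalkMap x).hom.FormallyUnramified) :
    ∃ U : X.Opens, x ∈ U ∧ Etale (U.ι ≫ f) := by
  obtain ⟨U, hxU, hU⟩ := exists_formallyUnramified_of_formallyUnramified_stalkMap f x hx
  refine ⟨U, hxU, ?_⟩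
  haveI := hU
  haveI : Flat (U.ι ≫ f) := inferInstance
  haveI : LocallyOfFinitePresentation (U.ι ≫ f) := inferInstance
  exact Etale.of_formallyUnramified_of_flat _

/-- **Étale near a point where the stalk map is an isomorphism**: for `f` flat and locally of finite presentation, if `f.stalkMap x` is an
isomorphism (e.g. `f` agrees near `x`, at the level of local rings, with an open immersion) then `f` is étale on an open neighbourhood of `x`
(an isomorphism is formally unramified). [cite: StacksProject, Tag 02GU] [cite: EGAIV4, Thm. 17.6.1] -/
theorem exists_etale_of_isIso_stalkMap [Flat f] [LocallyOfFinitePresentation f] (x : X) [IsIso (f.stalkMap x)] :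
    ∃ U : X.Opens, x ∈ U ∧ Etale (U.ι ≫ f) :=
  exists_etale_of_formallyUnramified_stalkMap f x
    (RingHom.FormallyUnramified.of_surjective (ConcreteCategory.bijective_of_isIso (f.stalkMap x)).2)

end Scheme

end Literature.AlgebraicGeometry.Morphisms

end
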